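import Literature.NumberTheory.GelbartRogawski1991.FinLocalSplittingsSplitSpherical
import Literature.NumberTheory.GelbartRogawski1991.LocalUnitarySplitPlaceDarboux
import HarnessLib

/-!
# (SPH) at the split places for every family of local splittings, and the survival clause

Topic `NumberTheory/GelbartRogawski1991`; namespace
`Literature.NumberTheory.GelbartRogawski1991.UnitaryDualPair.LocalSplitting.FinLocalSplittings`.  KERNEL ONLY:
theorems, 0 definitions, 0 records, 0 named facts, 0 sorry.  Sequel of `FinLocalSplittingsSplitSpherical` (the
`∀ᶠ v` assembly from Darboux data) and `LocalUnitarySplitPlaceDarboux` (the Darboux data `γ_w = splitDarboux`,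
`t = splitCoord`, [MoeglinVignerasWaldspurger1987, Chap. 2 III.1]): the instantiation; import cone = those two files.

* `eventually_unit_placeForm_mem_glInt` — for almost all `v` and all `w ∣ v`, `J_w = J ⊗ E_w ∈ GL_N(𝒪_w)`.
* **`eventually_forall_exists_shift_basis`** — for EVERY restricted family `𝓢 : FinLocalSplittings …` of local
  splittings over the embeddings `ι_v` ([GelbartRogawski1991, §3.1 Prop. 3.1.1]), for all but finitely many `v`, at
  every split `w ∣ v` and every generator `z₀` of `U(J₁)(F_v)/U(J₁)(𝒪_v)`: the `U(J)(𝒪_v)`-fixed vectors of the local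
  Weil representation `ω_v` lie in the span of a linearly independent family `b : ℤ → 𝒮(F_vᴺ)` with `b 0 = 1_{𝒪_vᴺ}`
  and `ω_v(z₀ · 1_N) (b j) = b (j+1)` — the hypothesis `hsph` of
  `Liu2021/Def411WeilCarriersSurvivalSplit.exists_finset_mk_unitVec_ne_zero_of_sph`, now a theorem.
* **`exists_finset_mk_unitVec_ne_zero`** — hence the SURVIVAL CLAUSE `hS` of
  `Def411WeilCarriers.rho_isIrreducible_of_lemD1AsPrinted_of_factors` ([Liu2021, Def. 4.11] `⊗'`): off a finite set of
  places the class of `1_{𝒪_vᴺ}` in the `χ_{1,v}`-coinvariants of `ω_v ∘ (z ↦ z · 1_N)` is non-zero, at split and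
  non-split places alike, for every `𝓢` (`N ≥ 1`, `T ∈ GL_N(F)`).

## References
* S. Gelbart, J. Rogawski, Invent. Math. 105 (1991), §3.1 (3.1.3) p. 456, §3.2 p. 457 [GelbartRogawski1991].
* C. Mœglin, M.-F. Vignéras, J.-L. Waldspurger, LNM 1291 (1987), Chap. 2 II.10, III.1 [MoeglinVignerasWaldspurger1987].
* Y. Liu, Camb. J. Math. 9 (2021) = arXiv:2102.11518, Def. 4.11 (l. 2092–2096), proof of Lem. D.1 (l. 5241–5245) [Liu2021].
-/

set_option autoImplicit false

noncomputable section

open scoped Matrix NNReal ValuativeRel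
open NumberField IsDedekindDomain Filter Set
open Literature.NumberTheory.Automorphic Literature.NumberTheory.Automorphic.UnitaryGroup
open Literature.RepresentationTheory Literature.RepresentationTheory.HeisenbergGroup
open Literature.NumberTheory.GaloisRepresentations.IsNonarchimedeanLocalField

namespace Literature.NumberTheory.GelbartRogawski1991.UnitaryDualPair.LocalSplitting.FinLocalSplittings

variable {F : Type} [Field F] [NumberField F] {E : Type} [Field E] [NumberField E] [Algebra F E]
  [Algebra.IsQuadraticExtension F E] {c : E ≃ₐ[F] E} {N : ℕ} {δ : E} {hcδ : c δ = -δ} {hδ : δ ≠ 0} {d : F}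
  {hd : δ * δ = algebraMap F E d} {T : Matrix (Fin N) (Fin N) F} {hT : T.IsSymm}
  {J : Matrix (Fin N) (Fin N) E} {hJ : J = T.map (algebraMap F E)}
  (𝓢 : FinLocalSplittings F E c N hcδ hδ hd T hT hJ) (J₁ : Matrix (Fin 1) (Fin 1) E) (hJ₁ : J₁ 0 0 ≠ 0)
  (hTd : IsUnit T.det)

/-! ## §1 `J_w ∈ GL_N(𝒪_w)` for almost all `w` -/

omit [NumberField F] [Algebra.IsQuadraticExtension F E] in
/-- an element of `E` is `w`-integral for almost all `w` (as a member of the valuation ring `𝒪[E_w]`).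
[cite: CasselsFrohlichANT1967, Ch. II §16] -/
theorem eventually_algebraMap_mem_integer (e : E) :
    ∀ᶠ w : HeightOneSpectrum (𝓞 E) in cofinite, algebraMap E (w.adicCompletion E) e ∈ 𝒪[w.adicCompletion E] := by
  have h : ∀ᶠ w : HeightOneSpectrum (𝓞 E) in cofinite, Valued.v (algebraMap E (w.adicCompletion E) e) ≤ 1 := by
    by_cases he : e = 0
    · exact Filter.Eventually.of_forall fun w => by rw [he, map_zero, map_zero]; exact zero_le_one
    · exact (UnitaryGroup.eventually_valued_algebraMap_eq_one (E := E) he).mono fun w hw => hw.le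
  refine h.mono fun w hw => ?_
  exact LocalFieldHaar.mem_primePowBall_zero_iff.1 ((Automorphic.mem_primePowBall_zero_iff _).2
    ((HeightOneSpectrum.mem_adicCompletionIntegers _ _ _).2 hw))

include hTd hJ in
omit [NumberField F] [NumberField E] [Algebra.IsQuadraticExtension F E] in
/-- `J = T ⊗ 1` is invertible (`det T` a unit). [cite: GelbartRogawski1991, §3.1 p. 454] -/
private theorem isUnit_J : IsUnit J := by
  rw [Matrix.isUnit_iff_isUnit_det, hJ]
  exact UnitaryGroup.isUnit_det_map (algebraMap F E) hTd

include hTd hJ in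
omit [NumberField F] [Algebra.IsQuadraticExtension F E] in
/-- **`J_w ∈ GL_N(𝒪_w)` for almost all `v` and all `w ∣ v`** (`J = T ⊗ 1`, `T ∈ GL_N(F)`: the entries of `J` and `J⁻¹`
are `w`-integral off a finite set; stated for every witness `hJw` of the invertibility of `J_w`).
[cite: PlatonovRapinchuk1994, §5.1] -/
theorem eventually_unit_placeForm_mem_glInt :
    ∀ᶠ v : HeightOneSpectrum (𝓞 F) in cofinite, ∀ (w : PlacesOver E v) (hJw : IsUnit (placeForm J w.1)),
      hJw.unit ∈ glInt N (w.1.adicCompletion E) := by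
  have hJd : IsUnit J.det := (Matrix.isUnit_iff_isUnit_det J).1 (isUnit_J (hJ := hJ) hTd)
  have hE : ∀ᶠ w : HeightOneSpectrum (𝓞 E) in cofinite, ∀ i j,
      algebraMap E (w.adicCompletion E) (J i j) ∈ 𝒪[w.adicCompletion E] ∧
        algebraMap E (w.adicCompletion E) (J⁻¹ i j) ∈ 𝒪[w.adicCompletion E] := by
    simp only [Filter.eventually_all]
    exact fun i j => (eventually_algebraMap_mem_integer (J i j)).and (eventually_algebraMap_mem_integer (J⁻¹ i j))
  filter_upwards [eventually_forall_placesOver (F := F) E hE] with v hv w hJw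
  rw [mem_glInt_iff]
  have hinv : ((hJw.unit⁻¹ : GL (Fin N) (w.1.adicCompletion E)) : Matrix (Fin N) (Fin N) (w.1.adicCompletion E)) =
      J⁻¹.map (algebraMap E (w.1.adicCompletion E)) := by
    rw [Matrix.coe_units_inv, IsUnit.unit_spec]
    refine Matrix.inv_eq_left_inv ?_
    rw [← Matrix.map_mul, Matrix.nonsing_inv_mul J hJd, Matrix.map_one _ (map_zero _) (map_one _)]
  refine ⟨fun i j => ?_, fun i j => ?_⟩
  · rw [IsUnit.unit_spec]; exact ((hv w) i j).1
  · rw [hinv, Matrix.map_apply]; exact ((hv w) i j).2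

/-! ## §2 (SPH) for every family of local splittings -/

include hTd in
/-- **(SPH) AT THE SPLIT PLACES, FOR EVERY RESTRICTED FAMILY OF LOCAL SPLITTINGS** — the hypothesis `hsph` of
`Liu2021/Def411WeilCarriersSurvivalSplit.exists_finset_mk_unitVec_ne_zero_of_sph` as a THEOREM: for all but finitely
many `v`, at every `w ∣ v` split in `E` and every generator `z₀` of `U(J₁)(F_v)` modulo `U(J₁)(𝒪_v)`, the
`U(J)(𝒪_v)`-fixed vectors of `ω_v = toRep ∘ s_v` lie in the span of the linearly independent family
`b j = ω_v(z₀ · 1_N)^{±j} 1_{𝒪_vᴺ}` with `b 0 = 1_{𝒪_vᴺ}`, `ω_v(z₀ · 1_N) (b j) = b (j + 1)` (Darboux data of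
`LocalUnitarySplitPlaceDarboux` fed into `eventually_forall_exists_shift_basis_of_darboux`).
[cite: GelbartRogawski1991, §3.1 (3.1.3) p. 456, §3.2 p. 457; MoeglinVignerasWaldspurger1987, Chap. 2 II.10, III.1] -/
theorem eventually_forall_exists_shift_basis [NeZero N] (hJ₁c : (J₁.map c)ᵀ = J₁) :
    ∀ᶠ v : HeightOneSpectrum (𝓞 F) in cofinite, ∀ w : PlacesOver E v, c • w.1 ≠ w.1 →
      ∀ z₀ : localPi E c 1 J₁ v,
        (∀ h : localPi E c 1 J₁ v, ∃ (k₀ : localPi E c 1 J₁ v) (m : ℤ), k₀ ∈ localInt E c 1 J₁ v ∧ h = k₀ * z₀ ^ m) →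
        ∃ b : ℤ → SchwartzBruhat (Fin N → v.adicCompletion F), b 0 = unitVec F (Fin N) v ∧ LinearIndependent ℂ b ∧
          (∀ j : ℤ, 𝓢.omegaLoc v (localCenter E c N J J₁ hJ₁ v z₀) (b j) = b (j + 1)) ∧
          (∀ u : SchwartzBruhat (Fin N → v.adicCompletion F),
            (∀ κ ∈ localInt E c N J v, 𝓢.omegaLoc v κ u = u) → u ∈ Submodule.span ℂ (Set.range b)) := by
  have hc : c ≠ 1 := by
    rintro rfl
    exact hδ (self_eq_neg.1 (by simpa only [AlgEquiv.one_apply] using hcδ))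
  -- `J = T ⊗ 1` is hermitian: `(c J)ᵀ = J` (`T` symmetric with entries in `F`)
  have hJc : (J.map c)ᵀ = J := by
    rw [hJ, Matrix.map_map, show (⇑c ∘ ⇑(algebraMap F E)) = ⇑(algebraMap F E) from funext fun t => c.commutes t,
      ← Matrix.transpose_map, hT.eq]
  have hJu : IsUnit J := isUnit_J (hJ := hJ) hTd
  refine 𝓢.eventually_forall_exists_shift_basis_of_darboux J₁ hJ₁ hTd
    (fun v w hw => splitDarboux F E c N hcδ hδ hd T v hT w hw)
    (fun v w z => splitCoord F E c hcδ hδ v w fun w' =>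
      (((z : LocalGLPi E 1 v) w' : GL (Fin 1) (w'.1.adicCompletion E)) : Matrix (Fin 1) (Fin 1) (w'.1.adicCompletion E)) 0 0)
    ?_ (fun v w hw z => valued_splitCoord F E c hcδ hδ hd v w hw _) ?_ ?_ ?_
  · -- `γ_w` preserves the box: `2` and `δ_w` are units
    filter_upwards [eventually_valued_two_eq_one (F := F),
      eventually_forall_valued_splitSqrt_eq_one F E c hcδ hδ hd] with v h2 hδv w hw
    exact splitDarboux_mapsTo F E c N hcδ hδ hd T v hT w hw h2 (hδv w hw)
  · -- the centre is the conjugated scalar Levi element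
    intro v w hw z a₀ ha₀
    exact iota_localCenter_eq F E c N hcδ hδ hd T hJ v hT hTd (isUnit_det_localGram F N T hTd v) w hw hJ₁ z a₀ ha₀
  · -- the compact part is the conjugate of `m(GL_N(𝒪_v))`
    filter_upwards [eventually_unit_placeForm_mem_glInt (hJ := hJ) hTd] with v hv w hw a
    exact exists_localInt_iota_eq F E c N hcδ hδ hd T hJ v hT hTd (isUnit_det_localGram F N T hTd v) hc hJc w hw
      (UnitaryGroup.isUnit_placeForm J hJu w.1) (hv w _) a
  · -- orientation of generators
    filter_upwards [eventually_forall_placesOver_valued_eq_one (F := F) (J₁ 0 0) hJ₁] with v hj w hw z₀ hz₀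
    exact valued_entry_eq_exp_or_of_generates F E c v hc hJ₁c w hw (hj w) z₀ hz₀

/-! ## §3 The survival clause at every place -/

include hTd in
/-- **THE SURVIVAL CLAUSE `hS` FOR EVERY FAMILY OF LOCAL SPLITTINGS**: there is a finite set of places `S₀` of `F` off
which the class of `1_{𝒪_vᴺ}` in the `χ_{1,v}`-coinvariants of `ω_v ∘ (z ↦ z · 1_N)` is NON-ZERO — the non-split half
(`Def411WeilCarriersSurvivalNonsplit`) and the split half (`…SurvivalSplit` + (SPH) above) combined; this is the
`hS` input of `Def411WeilCarriers.rho_isIrreducible_of_lemD1AsPrinted_of_factors` ([Liu2021] Def. 4.11 `⊗'`, proof of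
Lem. D.1 l. 5241–5245), for any continuous `χ₁` and any hermitian line `J₁ = (j)`, `c j = j ≠ 0`.
[cite: Liu2021, Def. 4.11 (l. 2092–2096)] -/
theorem exists_finset_mk_unitVec_ne_zero [NeZero N] (hJ₁c : (J₁.map c)ᵀ = J₁) {χ₁ : finAdelicOne F E c →* ℂˣ}
    (hχ₁ : Continuous χ₁) :
    ∃ S₀ : Finset (HeightOneSpectrum (𝓞 F)), ∀ v : HeightOneSpectrum (𝓞 F), v ∉ S₀ →
      TwistedCoinv.mk (show Representation ℂ (localPi E c 1 J₁ v) (SchwartzBruhat (Fin N → v.adicCompletion F)) from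
          (𝓢.omegaLoc v).comp (localCenter E c N J J₁ hJ₁ v))
        (localCharOfCenter F E c J₁ hJ₁ χ₁ v) (unitVec F (Fin N) v) ≠ 0 :=
  𝓢.exists_finset_mk_unitVec_ne_zero_of_sph J₁ hJ₁ hJ₁c hχ₁ (𝓢.eventually_forall_exists_shift_basis J₁ hJ₁ hTd hJ₁c)

end Literature.NumberTheory.GelbartRogawski1991.UnitaryDualPair.LocalSplitting.FinLocalSplittings
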